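import Summits.NavierStokesRegularity.NavierStokesRegularity.Theorems.ExtremiserTransienceNearExtremalTransienceExtremiserLiouvilleConstantSpeedSlideStretchingDensity
import Summits.NavierStokesRegularity.NavierStokesRegularity.Theorems.ExtremiserTransienceNearExtremalTransienceExtremiserLiouvilleConstantSpeedSlidePalinstrophyLimit
import Summits.NavierStokesRegularity.NavierStokesRegularity.Theorems.ExtremiserTransienceNearExtremalTransienceExtremiserLiouvilleConstantSpeedSlideKinematics
import HarnessLib

/-!
# Crux `ExtremiserTransience.NearExtremalTransience` (stmt-NavierStokesRegularity-21883), line `extremiser_liouville`,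
# stub K1b — THE STRETCHING VARIATION ALONG THE SLIDE IS LAYER-SUPPORTED (record §14 R6a-S: the axial rule applied)

`--supports stmt-NavierStokesRegularity-21883` (helper).  Author: prover seat `ns-el-k1b` (g9).

Identity (S) (`stretchingDensity_slideGenerator`, …SlideStretchingDensity) writes the `J₁`-density of `φ_g` as
`g·∂₂⟪ω,DVω⟫ + g′·T_A + g″·T_B`.  Here, for `V ∈ C^∞` with `‖DV‖ ≤ B`, `D¹V, D²V ∈ L²`, `g…g″` bounded and `g″ = 0` off a
square-integrable slab, the three parts are integrable and the axial rule `∫g∂₂p = −∫g′p` (…SlideKinematics) removes the only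
term that is not supported on the layer:
* `integrable_stretching_axialPart/tangentPart/crossPart` : the three densities are in `L¹`;
* `integral_stretchingDensity_slideGenerator` : **`∫(J₁-density of φ_g) = −∫g′⟪ω,DVω⟫ + ∫g′T_A + ∫g″T_B`** — every term of the
  stretching variation is `g′`/`g″`-weighted (lives on the layer), quadratic in `(ω, DV)` or bilinear in `(ω, D²V)`/`(ω, V)`:
  the input of the cubic absorption bound `|S·J₁| ≤ C·S·σ·(…)` of record §2 (S) / §14 R6a-S.

WHAT THIS IS NOT: K1b is NOT proved; nothing here proves NS regularity. [folklore]
-/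

noncomputable section

open Set Filter Topology MeasureTheory Metric Function InnerProductSpace
open scoped ENNReal NNReal Topology InnerProductSpace RealInnerProductSpace ContDiff
open Literature.Analysis.FluidPDE Literature.Analysis

namespace Summit.NavierStokesRegularity.NavierStokesRegularity.Theorems

-- the problem directory repeats the summit name (`NavierStokesRegularity/NavierStokesRegularity`)
set_option linter.dupNamespace false

namespace ExtremiserLiouville

open DepletionLadder.KStar

variable {V : EuclideanSpace ℝ (Fin 3) → EuclideanSpace ℝ (Fin 3)} {g : ℝ → ℝ}

/-! ## 1. Pointwise bounds -/

/-- `|yᵢ| ≤ ‖y‖` (local copy of the coordinate bound). [folklore] -/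
private theorem abs_coord_le (y : EuclideanSpace ℝ (Fin 3)) (i : Fin 3) : |y i| ≤ ‖y‖ := abs_apply_le_norm y i

/-- `‖A‖ ≤ 4‖DV‖ + ‖ω‖` for `A = (−2∂₂V₁, 2∂₂V₀, ω₂)`. [folklore] -/
theorem norm_slideA_le (x : EuclideanSpace ℝ (Fin 3)) :
    ‖(-2 * fderiv ℝ V x (EuclideanSpace.single (2 : Fin 3) (1 : ℝ)) 1) • EuclideanSpace.single (0 : Fin 3) (1 : ℝ) +
        (2 * fderiv ℝ V x (EuclideanSpace.single (2 : Fin 3) (1 : ℝ)) 0) • EuclideanSpace.single (1 : Fin 3) (1 : ℝ) +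
        (curl V x 2) • EuclideanSpace.single (2 : Fin 3) (1 : ℝ)‖ ≤ 4 * ‖fderiv ℝ V x‖ + ‖curl V x‖ := by
  set e₂ : EuclideanSpace ℝ (Fin 3) := EuclideanSpace.single (2 : Fin 3) (1 : ℝ) with he₂
  have hP : ‖fderiv ℝ V x e₂‖ ≤ ‖fderiv ℝ V x‖ := by
    have := (fderiv ℝ V x).le_opNorm e₂; rwa [he₂, PiLp.norm_single, norm_one, mul_one] at this
  have h1 : |fderiv ℝ V x e₂ 1| ≤ ‖fderiv ℝ V x‖ := (abs_coord_le _ 1).trans hP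
  have h0 : |fderiv ℝ V x e₂ 0| ≤ ‖fderiv ℝ V x‖ := (abs_coord_le _ 0).trans hP
  have h2 : |curl V x 2| ≤ ‖curl V x‖ := abs_coord_le _ 2
  have n0 : ‖EuclideanSpace.single (0 : Fin 3) (1 : ℝ)‖ = 1 := by rw [PiLp.norm_single, norm_one]
  have n1 : ‖EuclideanSpace.single (1 : Fin 3) (1 : ℝ)‖ = 1 := by rw [PiLp.norm_single, norm_one]
  have n2 : ‖e₂‖ = 1 := by rw [he₂, PiLp.norm_single, norm_one]
  refine (norm_add_le _ _).trans ((add_le_add (norm_add_le _ _) le_rfl).trans ?_)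
  rw [norm_smul, norm_smul, norm_smul, n0, n1, n2, mul_one, mul_one, mul_one, Real.norm_eq_abs, Real.norm_eq_abs,
    Real.norm_eq_abs, abs_mul, abs_mul, abs_neg, abs_two]
  linarith

/-- `‖V − V₂e₂‖ ≤ 2‖V‖`. [folklore] -/
theorem norm_horizontalPart_le (y : EuclideanSpace ℝ (Fin 3)) :
    ‖y - (y 2) • EuclideanSpace.single (2 : Fin 3) (1 : ℝ)‖ ≤ 2 * ‖y‖ := by
  refine (norm_sub_le _ _).trans ?_
  rw [norm_smul, PiLp.norm_single, norm_one, mul_one, Real.norm_eq_abs]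
  linarith [abs_coord_le y 2]

/-! ## 2. Integrability of the three parts of the stretching density -/

section Integrability

variable (hV : ContDiff ℝ ∞ V) {B K T : ℝ} (hB : ∀ x, ‖fderiv ℝ V x‖ ≤ B)
  (h1 : ∫⁻ x, ‖iteratedFDeriv ℝ 1 V x‖ₑ ^ 2 < ⊤) (h2 : ∫⁻ x, ‖iteratedFDeriv ℝ 2 V x‖ₑ ^ 2 < ⊤)

include hV h1 in
/-- `ω ∈ L²` and `DV ∈ L²` (as integrable squares), for `D¹V ∈ L²`. [folklore] -/
theorem integrable_sq_curl_and_fderiv :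
    Integrable (fun x => ‖curl V x‖ ^ 2) (volume : Measure (EuclideanSpace ℝ (Fin 3))) ∧
      Integrable (fun x => ‖fderiv ℝ V x‖ ^ 2) (volume : Measure (EuclideanSpace ℝ (Fin 3))) := by
  have hv1 : ContDiff ℝ 1 V := hV.of_le (WithTop.coe_le_coe.mpr le_top)
  have hD1 : Integrable (fun x => ‖iteratedFDeriv ℝ 1 V x‖ ^ 2) (volume : Measure (EuclideanSpace ℝ (Fin 3))) :=
    integrable_sq_norm_of_lintegral (hV.continuous_iteratedFDeriv (WithTop.coe_le_coe.mpr le_top)) h1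
  have mω : MemLp (curl V) 2 (volume : Measure (EuclideanSpace ℝ (Fin 3))) :=
    memLp_two_of_norm_le_mul (K := 4) (continuous_curl hv1) (hV.continuous_iteratedFDeriv (WithTop.coe_le_coe.mpr le_top))
      hD1 fun x => by
        have := norm_iteratedFDeriv_curl_le_four hV 0 x
        rwa [norm_iteratedFDeriv_zero] at this
  refine ⟨integrable_sq_of_memLp_two mω, hD1.congr (Eventually.of_forall fun x => ?_)⟩
  dsimp only
  rw [← norm_iteratedFDeriv_fderiv, norm_iteratedFDeriv_zero]

include hV hB h1 h2 in
/-- **The axial part `g·∂₂⟪ω,DVω⟫` is integrable** (`|g| ≤ K`; `∂₂⟪ω,DVω⟫` is a sum of three `L²·L²` products). [folklore] -/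
theorem integrable_stretching_axialPart (hgc : Continuous g) (hgK : ∀ s, |g s| ≤ K) :
    Integrable (fun x => g (x 2) * fderiv ℝ (fun y : EuclideanSpace ℝ (Fin 3) => ⟪curl V y, fderiv ℝ V y (curl V y)⟫) x (EuclideanSpace.single (2 : Fin 3) (1 : ℝ))) (volume : Measure (EuclideanSpace ℝ (Fin 3))) := by
  set e₂ : EuclideanSpace ℝ (Fin 3) := EuclideanSpace.single (2 : Fin 3) (1 : ℝ) with he₂
  have hK0 : 0 ≤ K := (abs_nonneg _).trans (hgK 0)
  have hB0 : 0 ≤ B := (norm_nonneg _).trans (hB 0)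
  have hv1 : ContDiff ℝ 1 V := hV.of_le (WithTop.coe_le_coe.mpr le_top)
  obtain ⟨iZ, iD⟩ := integrable_sq_curl_and_fderiv hV h1
  obtain ⟨cDω, mDω⟩ := memLp_fderiv_curl hV h2
  have iDω := integrable_sq_of_memLp_two mDω
  have hD2 : Integrable (fun x => ‖iteratedFDeriv ℝ 2 V x‖ ^ 2) (volume : Measure (EuclideanSpace ℝ (Fin 3))) :=
    integrable_sq_norm_of_lintegral (hV.continuous_iteratedFDeriv (WithTop.coe_le_coe.mpr le_top)) h2
  have cω : Continuous (curl V) := continuous_curl hv1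
  have cDV : Continuous (fderiv ℝ V) := hV.continuous_fderiv (by simp)
  have cP : Continuous fun x => fderiv ℝ (fun y => fderiv ℝ V y e₂) x :=
    ((hV.fderiv_right (m := ∞) (by exact_mod_cast le_rfl)).clm_apply contDiff_const).continuous_fderiv (by simp)
  have hωB : ∀ x, ‖curl V x‖ ≤ 4 * B := fun x => (norm_curl_le_four_mul V x).trans (by linarith [hB x])
  -- rewrite the density by `stretchingDensity_axial` and bound the three products
  have hpt : ∀ x, g (x 2) * fderiv ℝ (fun y : EuclideanSpace ℝ (Fin 3) => ⟪curl V y, fderiv ℝ V y (curl V y)⟫) x (EuclideanSpace.single (2 : Fin 3) (1 : ℝ)) =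
      g (x 2) * (⟪fderiv ℝ (curl V) x e₂, fderiv ℝ V x (curl V x)⟫ + ⟪curl V x, fderiv ℝ (fun y => fderiv ℝ V y e₂) x (curl V x)⟫ +
        ⟪curl V x, fderiv ℝ V x (fderiv ℝ (curl V) x e₂)⟫) := fun x => by rw [← stretchingDensity_axial hV x]
  refine Integrable.congr ?_ (Eventually.of_forall fun x => (hpt x).symm)
  have hmeas : AEStronglyMeasurable (fun x => g (x 2) * (⟪fderiv ℝ (curl V) x e₂, fderiv ℝ V x (curl V x)⟫ +
      ⟪curl V x, fderiv ℝ (fun y => fderiv ℝ V y e₂) x (curl V x)⟫ + ⟪curl V x, fderiv ℝ V x (fderiv ℝ (curl V) x e₂)⟫))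
      (volume : Measure (EuclideanSpace ℝ (Fin 3))) :=
    ((hgc.comp (PiLp.continuous_apply 2 _ (2 : Fin 3))).mul ((((cDω.clm_apply continuous_const).inner (cDV.clm_apply cω)).add
      (cω.inner (cP.clm_apply cω))).add (cω.inner (cDV.clm_apply (cDω.clm_apply continuous_const))))).aestronglyMeasurable
  refine (((iDω.add iZ).const_mul (K * (2 * B))).add ((iZ.add hD2).const_mul (K * (4 * B)))).mono' hmeas
    (Eventually.of_forall fun x => ?_)
  rw [Real.norm_eq_abs, abs_mul]
  simp only [Pi.add_apply]
  have hP1 : ‖fderiv ℝ (curl V) x e₂‖ ≤ ‖fderiv ℝ (curl V) x‖ := by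
    have := (fderiv ℝ (curl V) x).le_opNorm e₂; rwa [he₂, PiLp.norm_single, norm_one, mul_one] at this
  have hP2 : ‖fderiv ℝ (fun y => fderiv ℝ V y e₂) x (curl V x)‖ ≤ ‖iteratedFDeriv ℝ 2 V x‖ * ‖curl V x‖ := by
    refine ((fderiv ℝ (fun y => fderiv ℝ V y e₂) x).le_opNorm _).trans (mul_le_mul_of_nonneg_right ?_ (norm_nonneg _))
    have e1 : ‖iteratedFDeriv ℝ 0 (fderiv ℝ (fun y => fderiv ℝ V y e₂)) x‖ = ‖iteratedFDeriv ℝ 1 (fun y => fderiv ℝ V y e₂) x‖ :=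
      norm_iteratedFDeriv_fderiv
    have e2' : ‖iteratedFDeriv ℝ 1 (fderiv ℝ V) x‖ = ‖iteratedFDeriv ℝ 2 V x‖ := norm_iteratedFDeriv_fderiv
    rw [norm_iteratedFDeriv_zero] at e1
    rw [e1, ← e2']
    have := norm_iteratedFDeriv_clm_apply_const (f := fderiv ℝ V) (c := e₂) (n := 1)
      (((hV.fderiv_right (m := ∞) (by exact_mod_cast le_rfl)).of_le (by exact_mod_cast le_top)).contDiffAt (x := x)) le_rfl
    rwa [he₂, PiLp.norm_single, norm_one, one_mul] at this
  have t1 : |⟪fderiv ℝ (curl V) x e₂, fderiv ℝ V x (curl V x)⟫| ≤ B * (‖fderiv ℝ (curl V) x‖ * ‖curl V x‖) := by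
    refine (abs_real_inner_le_norm _ _).trans ?_
    calc ‖fderiv ℝ (curl V) x e₂‖ * ‖fderiv ℝ V x (curl V x)‖ ≤ ‖fderiv ℝ (curl V) x‖ * (B * ‖curl V x‖) :=
          mul_le_mul hP1 (((fderiv ℝ V x).le_opNorm _).trans (mul_le_mul_of_nonneg_right (hB x) (norm_nonneg _)))
            (norm_nonneg _) (norm_nonneg _)
      _ = B * (‖fderiv ℝ (curl V) x‖ * ‖curl V x‖) := by ring
  have t2 : |⟪curl V x, fderiv ℝ (fun y => fderiv ℝ V y e₂) x (curl V x)⟫| ≤ 4 * B * (‖curl V x‖ * ‖iteratedFDeriv ℝ 2 V x‖) := by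
    refine (abs_real_inner_le_norm _ _).trans ?_
    calc ‖curl V x‖ * ‖fderiv ℝ (fun y => fderiv ℝ V y e₂) x (curl V x)‖ ≤ ‖curl V x‖ * (‖iteratedFDeriv ℝ 2 V x‖ * (4 * B)) :=
          mul_le_mul_of_nonneg_left (hP2.trans (mul_le_mul_of_nonneg_left (hωB x) (norm_nonneg _))) (norm_nonneg _)
      _ = 4 * B * (‖curl V x‖ * ‖iteratedFDeriv ℝ 2 V x‖) := by ring
  have t3 : |⟪curl V x, fderiv ℝ V x (fderiv ℝ (curl V) x e₂)⟫| ≤ B * (‖fderiv ℝ (curl V) x‖ * ‖curl V x‖) := by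
    refine (abs_real_inner_le_norm _ _).trans ?_
    calc ‖curl V x‖ * ‖fderiv ℝ V x (fderiv ℝ (curl V) x e₂)‖ ≤ ‖curl V x‖ * (B * ‖fderiv ℝ (curl V) x‖) :=
          mul_le_mul_of_nonneg_left (((fderiv ℝ V x).le_opNorm _).trans (mul_le_mul (hB x) hP1 (norm_nonneg _) hB0)) (norm_nonneg _)
      _ = B * (‖fderiv ℝ (curl V) x‖ * ‖curl V x‖) := by ring
  have hsum := (abs_add_le _ _).trans (add_le_add ((abs_add_le _ _).trans (add_le_add t1 t2)) t3)
  have hg := hgK (x 2)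
  have a1 : ‖fderiv ℝ (curl V) x‖ * ‖curl V x‖ ≤ ‖fderiv ℝ (curl V) x‖ ^ 2 + ‖curl V x‖ ^ 2 := by
    nlinarith [sq_nonneg (‖fderiv ℝ (curl V) x‖ - ‖curl V x‖)]
  have a2 : ‖curl V x‖ * ‖iteratedFDeriv ℝ 2 V x‖ ≤ ‖curl V x‖ ^ 2 + ‖iteratedFDeriv ℝ 2 V x‖ ^ 2 := by
    nlinarith [sq_nonneg (‖curl V x‖ - ‖iteratedFDeriv ℝ 2 V x‖)]
  calc |g (x 2)| * |⟪fderiv ℝ (curl V) x e₂, fderiv ℝ V x (curl V x)⟫ + ⟪curl V x, fderiv ℝ (fun y => fderiv ℝ V y e₂) x (curl V x)⟫ +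
        ⟪curl V x, fderiv ℝ V x (fderiv ℝ (curl V) x e₂)⟫|
      ≤ K * (B * (‖fderiv ℝ (curl V) x‖ * ‖curl V x‖) + 4 * B * (‖curl V x‖ * ‖iteratedFDeriv ℝ 2 V x‖) +
          B * (‖fderiv ℝ (curl V) x‖ * ‖curl V x‖)) := mul_le_mul hg hsum (abs_nonneg _) hK0
    _ = K * (2 * B) * (‖fderiv ℝ (curl V) x‖ * ‖curl V x‖) + K * (4 * B) * (‖curl V x‖ * ‖iteratedFDeriv ℝ 2 V x‖) := by ring
    _ ≤ K * (2 * B) * (‖fderiv ℝ (curl V) x‖ ^ 2 + ‖curl V x‖ ^ 2) + K * (4 * B) * (‖curl V x‖ ^ 2 + ‖iteratedFDeriv ℝ 2 V x‖ ^ 2) :=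
        add_le_add (mul_le_mul_of_nonneg_left a1 (mul_nonneg hK0 (by linarith)))
          (mul_le_mul_of_nonneg_left a2 (mul_nonneg hK0 (by linarith)))

include hV hB h1 in
/-- **The tangential part `g′·T_A` is integrable** (`|g′| ≤ K`; `|T_A| ≤ B(4‖DV‖² + 9‖ω‖²)`). [folklore] -/
theorem integrable_stretching_tangentPart {γ : ℝ → ℝ} (hγc : Continuous γ) (hγK : ∀ s, |γ s| ≤ K) :
    Integrable (fun x => γ (x 2) *
          (⟪((-2 * fderiv ℝ V x (EuclideanSpace.single (2 : Fin 3) (1 : ℝ)) 1) • EuclideanSpace.single (0 : Fin 3) (1 : ℝ) + (2 * fderiv ℝ V x (EuclideanSpace.single (2 : Fin 3) (1 : ℝ)) 0) • EuclideanSpace.single (1 : Fin 3) (1 : ℝ) + (curl V x 2) • EuclideanSpace.single (2 : Fin 3) (1 : ℝ)), fderiv ℝ V x (curl V x)⟫ +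
            curl V x 2 * ⟪curl V x, fderiv ℝ V x (EuclideanSpace.single (2 : Fin 3) (1 : ℝ))⟫ +
            ⟪curl V x, fderiv ℝ V x (curl V x) - (fderiv ℝ V x (curl V x) 2) • EuclideanSpace.single (2 : Fin 3) (1 : ℝ)⟫ +
            ⟪curl V x, fderiv ℝ V x ((-2 * fderiv ℝ V x (EuclideanSpace.single (2 : Fin 3) (1 : ℝ)) 1) • EuclideanSpace.single (0 : Fin 3) (1 : ℝ) + (2 * fderiv ℝ V x (EuclideanSpace.single (2 : Fin 3) (1 : ℝ)) 0) • EuclideanSpace.single (1 : Fin 3) (1 : ℝ) + (curl V x 2) • EuclideanSpace.single (2 : Fin 3) (1 : ℝ))⟫)) (volume : Measure (EuclideanSpace ℝ (Fin 3))) := by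
  set e₂ : EuclideanSpace ℝ (Fin 3) := EuclideanSpace.single (2 : Fin 3) (1 : ℝ) with he₂
  have hK0 : 0 ≤ K := (abs_nonneg _).trans (hγK 0)
  have hB0 : 0 ≤ B := (norm_nonneg _).trans (hB 0)
  have hv1 : ContDiff ℝ 1 V := hV.of_le (WithTop.coe_le_coe.mpr le_top)
  obtain ⟨iZ, iD⟩ := integrable_sq_curl_and_fderiv hV h1
  have cω : Continuous (curl V) := continuous_curl hv1
  have cDV : Continuous (fderiv ℝ V) := hV.continuous_fderiv (by simp)
  have cV : Continuous V := hV.continuous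
  have c2 : Continuous fun x : EuclideanSpace ℝ (Fin 3) => x 2 := PiLp.continuous_apply 2 _ (2 : Fin 3)
  have cω2 : Continuous fun x => curl V x 2 := (PiLp.continuous_apply 2 _ (2 : Fin 3)).comp cω
  have cPe : Continuous fun x => fderiv ℝ V x e₂ := cDV.clm_apply continuous_const
  have cA : Continuous fun x => (-2 * fderiv ℝ V x e₂ 1) • (EuclideanSpace.single (0 : Fin 3) (1 : ℝ)) + (2 * fderiv ℝ V x e₂ 0) • (EuclideanSpace.single (1 : Fin 3) (1 : ℝ)) + (curl V x 2) • e₂ :=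
    (((continuous_const.mul ((PiLp.continuous_apply 2 _ (1 : Fin 3)).comp cPe)).smul continuous_const).add
      ((continuous_const.mul ((PiLp.continuous_apply 2 _ (0 : Fin 3)).comp cPe)).smul continuous_const)).add (cω2.smul continuous_const)
  have cDVω : Continuous fun x => fderiv ℝ V x (curl V x) := cDV.clm_apply cω
  have hmeas : AEStronglyMeasurable (fun x => γ (x 2) *
          (⟪((-2 * fderiv ℝ V x (EuclideanSpace.single (2 : Fin 3) (1 : ℝ)) 1) • EuclideanSpace.single (0 : Fin 3) (1 : ℝ) + (2 * fderiv ℝ V x (EuclideanSpace.single (2 : Fin 3) (1 : ℝ)) 0) • EuclideanSpace.single (1 : Fin 3) (1 : ℝ) + (curl V x 2) • EuclideanSpace.single (2 : Fin 3) (1 : ℝ)), fderiv ℝ V x (curl V x)⟫ +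
            curl V x 2 * ⟪curl V x, fderiv ℝ V x (EuclideanSpace.single (2 : Fin 3) (1 : ℝ))⟫ +
            ⟪curl V x, fderiv ℝ V x (curl V x) - (fderiv ℝ V x (curl V x) 2) • EuclideanSpace.single (2 : Fin 3) (1 : ℝ)⟫ +
            ⟪curl V x, fderiv ℝ V x ((-2 * fderiv ℝ V x (EuclideanSpace.single (2 : Fin 3) (1 : ℝ)) 1) • EuclideanSpace.single (0 : Fin 3) (1 : ℝ) + (2 * fderiv ℝ V x (EuclideanSpace.single (2 : Fin 3) (1 : ℝ)) 0) • EuclideanSpace.single (1 : Fin 3) (1 : ℝ) + (curl V x 2) • EuclideanSpace.single (2 : Fin 3) (1 : ℝ))⟫)) (volume : Measure (EuclideanSpace ℝ (Fin 3))) :=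
    ((hγc.comp c2).mul ((((cA.inner cDVω).add (cω2.mul (cω.inner cPe))).add
      (cω.inner (cDVω.sub (((PiLp.continuous_apply 2 _ (2 : Fin 3)).comp cDVω).smul continuous_const)))).add
      (cω.inner (cDV.clm_apply cA)))).aestronglyMeasurable
  refine (((iD.const_mul (K * B * 4)).add (iZ.const_mul (K * B * 9)))).mono' hmeas (Eventually.of_forall fun x => ?_)
  rw [Real.norm_eq_abs, abs_mul]
  simp only [Pi.add_apply]
  have hA := norm_slideA_le (V := V) x
  set a := ‖fderiv ℝ V x‖ with ha
  set z := ‖curl V x‖ with hz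
  have hA' : ‖(-2 * fderiv ℝ V x e₂ 1) • (EuclideanSpace.single (0 : Fin 3) (1 : ℝ)) + (2 * fderiv ℝ V x e₂ 0) • (EuclideanSpace.single (1 : Fin 3) (1 : ℝ)) + (curl V x 2) • e₂‖ ≤ 4 * a + z := hA
  have ha0 : 0 ≤ a := norm_nonneg _
  have hz0 : 0 ≤ z := norm_nonneg _
  have hDVω : ‖fderiv ℝ V x (curl V x)‖ ≤ B * z := ((fderiv ℝ V x).le_opNorm _).trans (mul_le_mul_of_nonneg_right (hB x) hz0)
  have hPe : ‖fderiv ℝ V x e₂‖ ≤ B := by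
    have := (fderiv ℝ V x).le_opNorm e₂; rw [he₂, PiLp.norm_single, norm_one, mul_one] at this; exact this.trans (hB x)
  have hω2 : |curl V x 2| ≤ z := abs_coord_le _ 2
  have t1 : |⟪(-2 * fderiv ℝ V x e₂ 1) • (EuclideanSpace.single (0 : Fin 3) (1 : ℝ)) + (2 * fderiv ℝ V x e₂ 0) • (EuclideanSpace.single (1 : Fin 3) (1 : ℝ)) + (curl V x 2) • e₂, fderiv ℝ V x (curl V x)⟫| ≤
      (4 * a + z) * (B * z) :=
    (abs_real_inner_le_norm _ _).trans (mul_le_mul hA' hDVω (norm_nonneg _) (by positivity))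
  have t2 : |curl V x 2 * ⟪curl V x, fderiv ℝ V x e₂⟫| ≤ z * (z * B) := by
    rw [abs_mul]
    exact mul_le_mul hω2 ((abs_real_inner_le_norm _ _).trans (mul_le_mul_of_nonneg_left hPe hz0)) (abs_nonneg _) hz0
  have t3 : |⟪curl V x, fderiv ℝ V x (curl V x) - (fderiv ℝ V x (curl V x) 2) • e₂⟫| ≤ z * (2 * (B * z)) := by
    refine (abs_real_inner_le_norm _ _).trans (mul_le_mul_of_nonneg_left ?_ hz0)
    exact (norm_horizontalPart_le _).trans (mul_le_mul_of_nonneg_left hDVω zero_le_two)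
  have t4 : |⟪curl V x, fderiv ℝ V x ((-2 * fderiv ℝ V x e₂ 1) • (EuclideanSpace.single (0 : Fin 3) (1 : ℝ)) + (2 * fderiv ℝ V x e₂ 0) • (EuclideanSpace.single (1 : Fin 3) (1 : ℝ)) + (curl V x 2) • e₂)⟫| ≤
      z * (B * (4 * a + z)) :=
    (abs_real_inner_le_norm _ _).trans (mul_le_mul_of_nonneg_left
      (((fderiv ℝ V x).le_opNorm _).trans (mul_le_mul (hB x) hA' (norm_nonneg _) hB0)) hz0)
  have hsum := (abs_add_le _ _).trans (add_le_add ((abs_add_le _ _).trans (add_le_add ((abs_add_le _ _).trans (add_le_add t1 t2)) t3)) t4)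
  calc |γ (x 2)| * |⟪(-2 * fderiv ℝ V x e₂ 1) • (EuclideanSpace.single (0 : Fin 3) (1 : ℝ)) + (2 * fderiv ℝ V x e₂ 0) • (EuclideanSpace.single (1 : Fin 3) (1 : ℝ)) + (curl V x 2) • e₂, fderiv ℝ V x (curl V x)⟫ +
        curl V x 2 * ⟪curl V x, fderiv ℝ V x e₂⟫ + ⟪curl V x, fderiv ℝ V x (curl V x) - (fderiv ℝ V x (curl V x) 2) • e₂⟫ +
        ⟪curl V x, fderiv ℝ V x ((-2 * fderiv ℝ V x e₂ 1) • (EuclideanSpace.single (0 : Fin 3) (1 : ℝ)) + (2 * fderiv ℝ V x e₂ 0) • (EuclideanSpace.single (1 : Fin 3) (1 : ℝ)) + (curl V x 2) • e₂)⟫|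
      ≤ K * ((4 * a + z) * (B * z) + z * (z * B) + z * (2 * (B * z)) + z * (B * (4 * a + z))) :=
        mul_le_mul (hγK _) hsum (abs_nonneg _) hK0
    _ = K * B * (8 * (a * z) + 5 * z ^ 2) := by ring
    _ ≤ K * B * 4 * a ^ 2 + K * B * 9 * z ^ 2 := by nlinarith [sq_nonneg (a - z), mul_nonneg hK0 hB0]

include hV hB h1 in
/-- **The cross part `g″·T_B` is integrable** (`|g″| ≤ K`, `g″ = 0` off the slab `{|x₂| ≤ T}`, slab square integrable;
`|T_B| ≤ 10B‖ω‖‖V‖`). [folklore] -/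
theorem integrable_stretching_crossPart {γ : ℝ → ℝ} (hγc : Continuous γ) (hγK : ∀ s, |γ s| ≤ K) (hγT : ∀ s, T < |s| → γ s = 0)
    (hslab : Integrable (fun x => {x : EuclideanSpace ℝ (Fin 3) | |x 2| ≤ T}.indicator (fun x => ‖V x‖ ^ 2) x) volume) :
    Integrable (fun x => γ (x 2) *
          (⟪((-V x 1) • EuclideanSpace.single (0 : Fin 3) (1 : ℝ) + (V x 0) • EuclideanSpace.single (1 : Fin 3) (1 : ℝ)), fderiv ℝ V x (curl V x)⟫ +
            curl V x 2 * ⟪curl V x, V x - (V x 2) • EuclideanSpace.single (2 : Fin 3) (1 : ℝ)⟫ +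
            ⟪curl V x, fderiv ℝ V x ((-V x 1) • EuclideanSpace.single (0 : Fin 3) (1 : ℝ) + (V x 0) • EuclideanSpace.single (1 : Fin 3) (1 : ℝ))⟫)) (volume : Measure (EuclideanSpace ℝ (Fin 3))) := by
  set e₂ : EuclideanSpace ℝ (Fin 3) := EuclideanSpace.single (2 : Fin 3) (1 : ℝ) with he₂
  set SL : Set (EuclideanSpace ℝ (Fin 3)) := {x | |x 2| ≤ T} with hSL
  have hK0 : 0 ≤ K := (abs_nonneg _).trans (hγK 0)
  have hB0 : 0 ≤ B := (norm_nonneg _).trans (hB 0)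
  have hv1 : ContDiff ℝ 1 V := hV.of_le (WithTop.coe_le_coe.mpr le_top)
  obtain ⟨iZ, -⟩ := integrable_sq_curl_and_fderiv hV h1
  have cω : Continuous (curl V) := continuous_curl hv1
  have cDV : Continuous (fderiv ℝ V) := hV.continuous_fderiv (by simp)
  have cV : Continuous V := hV.continuous
  have c2 : Continuous fun x : EuclideanSpace ℝ (Fin 3) => x 2 := PiLp.continuous_apply 2 _ (2 : Fin 3)
  have cω2 : Continuous fun x => curl V x 2 := (PiLp.continuous_apply 2 _ (2 : Fin 3)).comp cω
  have cB : Continuous fun x => (-V x 1) • (EuclideanSpace.single (0 : Fin 3) (1 : ℝ)) + (V x 0) • (EuclideanSpace.single (1 : Fin 3) (1 : ℝ)) :=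
    ((((PiLp.continuous_apply 2 _ (1 : Fin 3)).comp cV).neg.smul continuous_const)).add
      (((PiLp.continuous_apply 2 _ (0 : Fin 3)).comp cV).smul continuous_const)
  have cDVω : Continuous fun x => fderiv ℝ V x (curl V x) := cDV.clm_apply cω
  have cW : Continuous fun x => V x - (V x 2) • e₂ := cV.sub (((PiLp.continuous_apply 2 _ (2 : Fin 3)).comp cV).smul continuous_const)
  have hmeas : AEStronglyMeasurable (fun x => γ (x 2) *
          (⟪((-V x 1) • EuclideanSpace.single (0 : Fin 3) (1 : ℝ) + (V x 0) • EuclideanSpace.single (1 : Fin 3) (1 : ℝ)), fderiv ℝ V x (curl V x)⟫ +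
            curl V x 2 * ⟪curl V x, V x - (V x 2) • EuclideanSpace.single (2 : Fin 3) (1 : ℝ)⟫ +
            ⟪curl V x, fderiv ℝ V x ((-V x 1) • EuclideanSpace.single (0 : Fin 3) (1 : ℝ) + (V x 0) • EuclideanSpace.single (1 : Fin 3) (1 : ℝ))⟫)) (volume : Measure (EuclideanSpace ℝ (Fin 3))) :=
    ((hγc.comp c2).mul (((cB.inner cDVω).add (cω2.mul (cω.inner cW))).add (cω.inner (cDV.clm_apply cB)))).aestronglyMeasurable
  refine (((iZ.const_mul (5 * B * K)).add (hslab.const_mul (5 * B * K)))).mono' hmeas (Eventually.of_forall fun x => ?_)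
  rw [Real.norm_eq_abs, abs_mul]
  simp only [Pi.add_apply]
  set z := ‖curl V x‖ with hz
  set n := ‖V x‖ with hn
  have hz0 : 0 ≤ z := norm_nonneg _
  have hn0 : 0 ≤ n := norm_nonneg _
  have hBn : ‖(-V x 1) • (EuclideanSpace.single (0 : Fin 3) (1 : ℝ)) + (V x 0) • (EuclideanSpace.single (1 : Fin 3) (1 : ℝ))‖ ≤ n := norm_cross_le (V x)
  have hDVω : ‖fderiv ℝ V x (curl V x)‖ ≤ B * z := ((fderiv ℝ V x).le_opNorm _).trans (mul_le_mul_of_nonneg_right (hB x) hz0)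
  have hωB : z ≤ 4 * B := (norm_curl_le_four_mul V x).trans (by linarith [hB x])
  have hω2 : |curl V x 2| ≤ z := abs_coord_le _ 2
  have t1 : |⟪(-V x 1) • (EuclideanSpace.single (0 : Fin 3) (1 : ℝ)) + (V x 0) • (EuclideanSpace.single (1 : Fin 3) (1 : ℝ)), fderiv ℝ V x (curl V x)⟫| ≤ n * (B * z) :=
    (abs_real_inner_le_norm _ _).trans (mul_le_mul hBn hDVω (norm_nonneg _) hn0)
  have t2 : |curl V x 2 * ⟪curl V x, V x - (V x 2) • e₂⟫| ≤ z * ((4 * B) * (2 * n)) := by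
    rw [abs_mul]
    refine mul_le_mul hω2 ((abs_real_inner_le_norm _ _).trans (mul_le_mul hωB (norm_horizontalPart_le _) (norm_nonneg _)
      (by positivity))) (abs_nonneg _) hz0
  have t3 : |⟪curl V x, fderiv ℝ V x ((-V x 1) • (EuclideanSpace.single (0 : Fin 3) (1 : ℝ)) + (V x 0) • (EuclideanSpace.single (1 : Fin 3) (1 : ℝ)))⟫| ≤ z * (B * n) :=
    (abs_real_inner_le_norm _ _).trans (mul_le_mul_of_nonneg_left
      (((fderiv ℝ V x).le_opNorm _).trans (mul_le_mul (hB x) hBn (norm_nonneg _) hB0)) hz0)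
  have hsum := (abs_add_le _ _).trans (add_le_add ((abs_add_le _ _).trans (add_le_add t1 t2)) t3)
  -- `|γ(x₂)| n² ≤ K 𝟙_SL n²`
  have hslabpt : |γ (x 2)| * n ^ 2 ≤ K * SL.indicator (fun x => ‖V x‖ ^ 2) x := by
    by_cases hx : x ∈ SL
    · rw [Set.indicator_of_mem hx]; exact mul_le_mul_of_nonneg_right (hγK _) (sq_nonneg _)
    · have hx' : T < |x 2| := not_le.1 hx
      rw [hγT _ hx', abs_zero, zero_mul, Set.indicator_of_notMem hx, mul_zero]
  have hγx : |γ (x 2)| ≤ K := hγK _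
  calc |γ (x 2)| * |⟪(-V x 1) • (EuclideanSpace.single (0 : Fin 3) (1 : ℝ)) + (V x 0) • (EuclideanSpace.single (1 : Fin 3) (1 : ℝ)), fderiv ℝ V x (curl V x)⟫ +
        curl V x 2 * ⟪curl V x, V x - (V x 2) • e₂⟫ + ⟪curl V x, fderiv ℝ V x ((-V x 1) • (EuclideanSpace.single (0 : Fin 3) (1 : ℝ)) + (V x 0) • (EuclideanSpace.single (1 : Fin 3) (1 : ℝ)))⟫|
      ≤ |γ (x 2)| * (n * (B * z) + z * ((4 * B) * (2 * n)) + z * (B * n)) := mul_le_mul_of_nonneg_left hsum (abs_nonneg _)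
    _ = (10 * B) * (|γ (x 2)| * (z * n)) := by ring
    _ ≤ (10 * B) * (|γ (x 2)| * ((z ^ 2 + n ^ 2) / 2)) := by
        refine mul_le_mul_of_nonneg_left (mul_le_mul_of_nonneg_left ?_ (abs_nonneg _)) (by positivity)
        nlinarith [sq_nonneg (z - n)]
    _ = 5 * B * (|γ (x 2)| * z ^ 2) + 5 * B * (|γ (x 2)| * n ^ 2) := by ring
    _ ≤ 5 * B * K * z ^ 2 + 5 * B * K * SL.indicator (fun x => ‖V x‖ ^ 2) x := by
        have h1' : |γ (x 2)| * z ^ 2 ≤ K * z ^ 2 := mul_le_mul_of_nonneg_right hγx (sq_nonneg _)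
        nlinarith [mul_le_mul_of_nonneg_left h1' (show (0:ℝ) ≤ 5 * B by positivity),
          mul_le_mul_of_nonneg_left hslabpt (show (0:ℝ) ≤ 5 * B by positivity)]

include hV hB h1 in
/-- `w(x₂)·⟪ω, DVω⟫` is integrable for bounded continuous `w` (`|⟪ω,DVω⟫| ≤ B‖ω‖²`). [folklore] -/
theorem integrable_weight_mul_stretching {w : ℝ → ℝ} (hwc : Continuous w) (hwK : ∀ s, |w s| ≤ K) :
    Integrable (fun x => w (x 2) * ⟪curl V x, fderiv ℝ V x (curl V x)⟫) (volume : Measure (EuclideanSpace ℝ (Fin 3))) := by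
  have hK0 : 0 ≤ K := (abs_nonneg _).trans (hwK 0)
  have hv1 : ContDiff ℝ 1 V := hV.of_le (WithTop.coe_le_coe.mpr le_top)
  obtain ⟨iZ, -⟩ := integrable_sq_curl_and_fderiv hV h1
  have cω : Continuous (curl V) := continuous_curl hv1
  have cDV : Continuous (fderiv ℝ V) := hV.continuous_fderiv (by simp)
  refine (iZ.const_mul (K * B)).mono' (((hwc.comp (PiLp.continuous_apply 2 _ (2 : Fin 3))).mul
    (cω.inner (cDV.clm_apply cω))).aestronglyMeasurable) (Eventually.of_forall fun x => ?_)
  rw [Real.norm_eq_abs, abs_mul]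
  have h1' : |⟪curl V x, fderiv ℝ V x (curl V x)⟫| ≤ B * ‖curl V x‖ ^ 2 := by
    refine (abs_real_inner_le_norm _ _).trans ?_
    calc ‖curl V x‖ * ‖fderiv ℝ V x (curl V x)‖ ≤ ‖curl V x‖ * (B * ‖curl V x‖) :=
          mul_le_mul_of_nonneg_left (((fderiv ℝ V x).le_opNorm _).trans (mul_le_mul_of_nonneg_right (hB x) (norm_nonneg _)))
            (norm_nonneg _)
      _ = B * ‖curl V x‖ ^ 2 := by ring
  calc |w (x 2)| * |⟪curl V x, fderiv ℝ V x (curl V x)⟫| ≤ K * (B * ‖curl V x‖ ^ 2) :=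
        mul_le_mul (hwK _) h1' (abs_nonneg _) hK0
    _ = K * B * ‖curl V x‖ ^ 2 := by ring

end Integrability

/-! ## 3. The stretching variation, layer-supported -/

/-- **`∫(J₁-density of φ_g) = −∫g′⟪ω,DVω⟫ + ∫g′·T_A + ∫g″·T_B`**: identity (S) integrated, the axial part converted by the
axial rule `∫g∂₂p = −∫g′p` (only `V, DV, D²V`; `‖DV‖ ≤ B`, `D¹V, D²V ∈ L²`, `g, g′, g″` bounded, `g″ = 0` off a
square-integrable slab). [folklore] -/
theorem integral_stretchingDensity_slideGenerator (hV : ContDiff ℝ ∞ V) (hg : ContDiff ℝ ∞ g) {B T K0 K1 K2 : ℝ}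
    (hB : ∀ x, ‖fderiv ℝ V x‖ ≤ B) (hK0 : ∀ s, |g s| ≤ K0) (hK1 : ∀ s, |deriv g s| ≤ K1) (hK2 : ∀ s, |deriv (deriv g) s| ≤ K2)
    (hT2 : ∀ s, T < |s| → deriv (deriv g) s = 0)
    (h1 : ∫⁻ x, ‖iteratedFDeriv ℝ 1 V x‖ₑ ^ 2 < ⊤) (h2 : ∫⁻ x, ‖iteratedFDeriv ℝ 2 V x‖ₑ ^ 2 < ⊤)
    (hslab : Integrable (fun x => {x : EuclideanSpace ℝ (Fin 3) | |x 2| ≤ T}.indicator (fun x => ‖V x‖ ^ 2) x) volume) :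
    (∫ x, (g (x 2) * fderiv ℝ (fun y : EuclideanSpace ℝ (Fin 3) => ⟪curl V y, fderiv ℝ V y (curl V y)⟫) x (EuclideanSpace.single (2 : Fin 3) (1 : ℝ)) +
        deriv g (x 2) *
          (⟪((-2 * fderiv ℝ V x (EuclideanSpace.single (2 : Fin 3) (1 : ℝ)) 1) • EuclideanSpace.single (0 : Fin 3) (1 : ℝ) + (2 * fderiv ℝ V x (EuclideanSpace.single (2 : Fin 3) (1 : ℝ)) 0) • EuclideanSpace.single (1 : Fin 3) (1 : ℝ) + (curl V x 2) • EuclideanSpace.single (2 : Fin 3) (1 : ℝ)), fderiv ℝ V x (curl V x)⟫ +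
            curl V x 2 * ⟪curl V x, fderiv ℝ V x (EuclideanSpace.single (2 : Fin 3) (1 : ℝ))⟫ +
            ⟪curl V x, fderiv ℝ V x (curl V x) - (fderiv ℝ V x (curl V x) 2) • EuclideanSpace.single (2 : Fin 3) (1 : ℝ)⟫ +
            ⟪curl V x, fderiv ℝ V x ((-2 * fderiv ℝ V x (EuclideanSpace.single (2 : Fin 3) (1 : ℝ)) 1) • EuclideanSpace.single (0 : Fin 3) (1 : ℝ) + (2 * fderiv ℝ V x (EuclideanSpace.single (2 : Fin 3) (1 : ℝ)) 0) • EuclideanSpace.single (1 : Fin 3) (1 : ℝ) + (curl V x 2) • EuclideanSpace.single (2 : Fin 3) (1 : ℝ))⟫) +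
        deriv (deriv g) (x 2) *
          (⟪((-V x 1) • EuclideanSpace.single (0 : Fin 3) (1 : ℝ) + (V x 0) • EuclideanSpace.single (1 : Fin 3) (1 : ℝ)), fderiv ℝ V x (curl V x)⟫ +
            curl V x 2 * ⟪curl V x, V x - (V x 2) • EuclideanSpace.single (2 : Fin 3) (1 : ℝ)⟫ +
            ⟪curl V x, fderiv ℝ V x ((-V x 1) • EuclideanSpace.single (0 : Fin 3) (1 : ℝ) + (V x 0) • EuclideanSpace.single (1 : Fin 3) (1 : ℝ))⟫))) =
      -(∫ x, deriv g (x 2) * ⟪curl V x, fderiv ℝ V x (curl V x)⟫) +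
        (∫ x, deriv g (x 2) *
          (⟪((-2 * fderiv ℝ V x (EuclideanSpace.single (2 : Fin 3) (1 : ℝ)) 1) • EuclideanSpace.single (0 : Fin 3) (1 : ℝ) + (2 * fderiv ℝ V x (EuclideanSpace.single (2 : Fin 3) (1 : ℝ)) 0) • EuclideanSpace.single (1 : Fin 3) (1 : ℝ) + (curl V x 2) • EuclideanSpace.single (2 : Fin 3) (1 : ℝ)), fderiv ℝ V x (curl V x)⟫ +
            curl V x 2 * ⟪curl V x, fderiv ℝ V x (EuclideanSpace.single (2 : Fin 3) (1 : ℝ))⟫ +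
            ⟪curl V x, fderiv ℝ V x (curl V x) - (fderiv ℝ V x (curl V x) 2) • EuclideanSpace.single (2 : Fin 3) (1 : ℝ)⟫ +
            ⟪curl V x, fderiv ℝ V x ((-2 * fderiv ℝ V x (EuclideanSpace.single (2 : Fin 3) (1 : ℝ)) 1) • EuclideanSpace.single (0 : Fin 3) (1 : ℝ) + (2 * fderiv ℝ V x (EuclideanSpace.single (2 : Fin 3) (1 : ℝ)) 0) • EuclideanSpace.single (1 : Fin 3) (1 : ℝ) + (curl V x 2) • EuclideanSpace.single (2 : Fin 3) (1 : ℝ))⟫)) +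
        ∫ x, deriv (deriv g) (x 2) *
          (⟪((-V x 1) • EuclideanSpace.single (0 : Fin 3) (1 : ℝ) + (V x 0) • EuclideanSpace.single (1 : Fin 3) (1 : ℝ)), fderiv ℝ V x (curl V x)⟫ +
            curl V x 2 * ⟪curl V x, V x - (V x 2) • EuclideanSpace.single (2 : Fin 3) (1 : ℝ)⟫ +
            ⟪curl V x, fderiv ℝ V x ((-V x 1) • EuclideanSpace.single (0 : Fin 3) (1 : ℝ) + (V x 0) • EuclideanSpace.single (1 : Fin 3) (1 : ℝ))⟫) := by
  have hv1 : ContDiff ℝ 1 V := hV.of_le (WithTop.coe_le_coe.mpr le_top)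
  have hg1 : ContDiff ℝ 1 g := hg.of_le (WithTop.coe_le_coe.mpr le_top)
  have hγ : ContDiff ℝ ∞ (deriv g) := (contDiff_infty_iff_deriv.mp hg).2
  have hγ' : ContDiff ℝ ∞ (deriv (deriv g)) := (contDiff_infty_iff_deriv.mp hγ).2
  have hω : ContDiff ℝ ∞ (curl V) := contDiff_curl (n := ⊤) (hV.of_le (by exact_mod_cast le_top))
  have hp : ContDiff ℝ 1 fun y : EuclideanSpace ℝ (Fin 3) => ⟪curl V y, fderiv ℝ V y (curl V y)⟫ :=
    (hω.inner ℝ ((hV.fderiv_right (m := ∞) (by exact_mod_cast le_rfl)).clm_apply hω)).of_le (WithTop.coe_le_coe.mpr le_top)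
  have iA := integrable_stretching_axialPart hV hB h1 h2 hg.continuous hK0
  have iT := integrable_stretching_tangentPart hV hB h1 hγ.continuous hK1
  have iC := integrable_stretching_crossPart hV hB h1 hγ'.continuous hK2 hT2 hslab
  have i0 := integrable_weight_mul_stretching hV hB h1 hg.continuous hK0
  have i1 := integrable_weight_mul_stretching hV hB h1 hγ.continuous hK1
  have hax := integral_axialWeight_deriv_mul_eq hp hg1 i0 i1 iA
  have i12 : Integrable (fun x => g (x 2) * fderiv ℝ (fun y : EuclideanSpace ℝ (Fin 3) => ⟪curl V y, fderiv ℝ V y (curl V y)⟫) x (EuclideanSpace.single (2 : Fin 3) (1 : ℝ)) +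
        deriv g (x 2) *
          (⟪((-2 * fderiv ℝ V x (EuclideanSpace.single (2 : Fin 3) (1 : ℝ)) 1) • EuclideanSpace.single (0 : Fin 3) (1 : ℝ) + (2 * fderiv ℝ V x (EuclideanSpace.single (2 : Fin 3) (1 : ℝ)) 0) • EuclideanSpace.single (1 : Fin 3) (1 : ℝ) + (curl V x 2) • EuclideanSpace.single (2 : Fin 3) (1 : ℝ)), fderiv ℝ V x (curl V x)⟫ +
            curl V x 2 * ⟪curl V x, fderiv ℝ V x (EuclideanSpace.single (2 : Fin 3) (1 : ℝ))⟫ +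
            ⟪curl V x, fderiv ℝ V x (curl V x) - (fderiv ℝ V x (curl V x) 2) • EuclideanSpace.single (2 : Fin 3) (1 : ℝ)⟫ +
            ⟪curl V x, fderiv ℝ V x ((-2 * fderiv ℝ V x (EuclideanSpace.single (2 : Fin 3) (1 : ℝ)) 1) • EuclideanSpace.single (0 : Fin 3) (1 : ℝ) + (2 * fderiv ℝ V x (EuclideanSpace.single (2 : Fin 3) (1 : ℝ)) 0) • EuclideanSpace.single (1 : Fin 3) (1 : ℝ) + (curl V x 2) • EuclideanSpace.single (2 : Fin 3) (1 : ℝ))⟫)) (volume : Measure (EuclideanSpace ℝ (Fin 3))) := iA.add iT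
  rw [integral_add i12 iC, integral_add iA iT, hax, neg_neg]

end ExtremiserLiouville

end Summit.NavierStokesRegularity.NavierStokesRegularity.Theorems

end
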